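import Literature.NumberTheory.Automorphic.ShimuraCurveDataExistence
import Literature.NumberTheory.Automorphic.FundamentalDomainUnfolding
import Literature.NumberTheory.Automorphic.AutomorphicKernelOperators
import HarnessLib

/-!
# Dirichlet fundamental domains of cocompact discrete subgroups of `SL₂(ℝ)`:
# an open/closed pair `F₀ ⊆ F₁` with null difference and null boundaries
# (Vignéras, LNM 800, Ch. IV §2; Beardon, GTM 91, §9.4)

Topic `NumberTheory/Automorphic`; theorems only (no definition, no named fact, no instance).
For a subgroup `Γ ≤ SL₂(ℝ)` (inside `GL₂(ℝ)`), discrete in the sense of the tree's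
`IsDiscreteSubgroup` and **cocompact** (`∃ K` compact with `Γ K = ℍ`), we construct the
Dirichlet domain centred at a point `p` with trivial stabiliser in `Γ̄ = Γ/{±1}`:

  `F₀ = {z : ρ(z, p) < ρ(z, γ p) for all γ ∈ Γ with γ p ≠ p}` (open),
  `F₁ = {z : ρ(z, p) ≤ ρ(z, γ p) for all γ ∈ Γ}` (closed),

and prove (`exists_dirichletDomain_pair`): `F₀ ⊆ F₁`; `F₁` is contained in a compact ball; every
orbit meets `F₁`; **two points of `F₀` in the same orbit differ by `±1`** (so no point of `F₀` is
elliptic); `F₁ ∖ F₀` is contained in countably many perpendicular bisectors, which are Euclidean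
circles or lines and hence NULL for the hyperbolic measure (`volume_setOf_dist_eq_dist`), so that
`μ(F₁ ∖ F₀) = μ(∂F₀) = μ(∂F₁) = 0`; and `F₁` is a fundamental domain in the tree's measure-theoretic
sense `IsHypFundamentalDomain`. A base point with trivial stabiliser exists because the fixed
points of the countably many non-central elements form a countable set
(`exists_forall_smul_eq_self_imp`; an element of `SL₂(ℝ)` fixing two points of `ℍ` is `±1`,
tree `eq_one_or_neg_one_of_fixed_two`), and orbits are locally finite (tree `finite_hypBall` / `finite_dist_le`).

This is the pair of domains between which Eichler's lattice-point count is sandwiched in the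
`D > 1` branch of the proof of `Literature.NumberTheory.Automorphic.ShimuraCurveData.volume_fd_eq`
(brick "S3d"): lattice points are counted exactly, so one needs pointwise — not almost-everywhere —
uniqueness on `F₀` and covering by `F₁`, with `μ(F₀) = μ(F₁)`.

## References

* M.-F. Vignéras, *Arithmétique des algèbres de quaternions*, LNM 800 (1980), Ch. IV §1
  Thm. 1.1, §2 (domaine fondamental de Dirichlet) [VignerasLNM800].
* A. F. Beardon, *The Geometry of Discrete Groups*, GTM 91 (1983), §9.4 (Dirichlet polygons).
-/

noncomputable section

open _root_.MeasureTheory Set Filter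
open scoped MatrixGroups Topology

namespace Literature.NumberTheory.Automorphic

open UpperHalfPlane

variable {Γ : Subgroup (GL (Fin 2) ℝ)}

/-! ### 1. Isometries, a non-elliptic base point -/

/-- Elements of `SL₂(ℝ) ≤ GL₂(ℝ)` act on `ℍ` by hyperbolic isometries. [folklore] -/
theorem dist_smul_smul_of_mem_range {γ : GL (Fin 2) ℝ}
    (hγ : γ ∈ (Matrix.SpecialLinearGroup.toGL : SL(2, ℝ) →* GL (Fin 2) ℝ).range) (z w : ℍ) :
    dist (γ • z) (γ • w) = dist z w := by
  obtain ⟨g, rfl⟩ := hγ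
  exact dist_smul g z w

/-- `ρ(z, γ p) = ρ(γ⁻¹ z, p)` for `γ ∈ SL₂(ℝ)`. [folklore] -/
theorem dist_smul_eq_dist_inv_smul {γ : GL (Fin 2) ℝ}
    (hγ : γ ∈ (Matrix.SpecialLinearGroup.toGL : SL(2, ℝ) →* GL (Fin 2) ℝ).range) (z p : ℍ) :
    dist z (γ • p) = dist (γ⁻¹ • z) p := by
  rw [← dist_smul_smul_of_mem_range (inv_mem hγ) z (γ • p), inv_smul_smul]

/-- **A discrete subgroup of `SL₂(ℝ)` has a point with trivial stabiliser in `Γ/{±1}`**: the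
non-central elements are countably many and each fixes at most one point of `ℍ`
(`eq_one_or_neg_one_of_fixed_two`), while `ℍ` is uncountable. [folklore] -/
theorem exists_forall_smul_eq_self_imp
    (hΓ : Γ ≤ (Matrix.SpecialLinearGroup.toGL : SL(2, ℝ) →* GL (Fin 2) ℝ).range)
    (hd : IsDiscreteSubgroup Γ) :
    ∃ p : ℍ, ∀ γ ∈ Γ, γ • p = p → γ = 1 ∨ γ = -1 := by
  haveI := hd.countable_subtype
  set E : Set ℍ := {z | ∃ γ ∈ Γ, γ ≠ 1 ∧ γ ≠ -1 ∧ γ • z = z} with hE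
  have hcount : E.Countable := by
    have hsub : E ⊆ ⋃ γ : Γ, {z : ℍ | (γ : GL (Fin 2) ℝ) ≠ 1 ∧ (γ : GL (Fin 2) ℝ) ≠ -1 ∧
        (γ : GL (Fin 2) ℝ) • z = z} := by
      rintro z ⟨γ, hγ, h1, h2, hz⟩
      exact mem_iUnion.mpr ⟨⟨γ, hγ⟩, h1, h2, hz⟩
    refine (Set.countable_iUnion fun γ => Set.Subsingleton.finite ?_ |>.countable).mono hsub
    rintro z ⟨h1, h2, hz⟩ w ⟨-, -, hw⟩
    by_contra hne
    rcases eq_one_or_neg_one_of_fixed_two (hΓ γ.2) hne hz hw with h | h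
    exacts [h1 h, h2 h]
  have huniv : ¬ (Set.univ : Set ℍ).Countable := by
    intro h
    have hinj : Function.Injective fun t : ℝ => (⟨⟨t, 1⟩, one_pos⟩ : ℍ) := by
      intro s t hst
      have := congrArg (fun z : ℍ => z.re) hst
      simpa using this
    have : (Set.univ : Set ℝ).Countable := by
      have := h.preimage hinj
      rwa [Set.preimage_univ] at this
    exact Cardinal.not_countable_real this
  obtain ⟨p, hp⟩ : ∃ p : ℍ, p ∉ E := by
    by_contra h
    simp only [not_exists, not_not] at h
    exact huniv (hcount.mono fun z _ => h z)
  refine ⟨p, fun γ hγ hfix => ?_⟩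
  by_contra h
  simp only [not_or] at h
  exact hp ⟨γ, hγ, h.1, h.2, hfix⟩

/-! ### 2. Perpendicular bisectors are null -/

/-- A real polynomial `a x² + b x + c` with `(a, b) ≠ (0, 0)` has finitely many zeros. [folklore] -/
theorem finite_setOf_quadratic_eq_zero {a b c : ℝ} (hab : a ≠ 0 ∨ b ≠ 0) :
    {x : ℝ | a * x ^ 2 + b * x + c = 0}.Finite := by
  classical
  set P : Polynomial ℝ := Polynomial.C a * Polynomial.X ^ 2 + Polynomial.C b * Polynomial.X +
    Polynomial.C c with hP
  have hP0 : P ≠ 0 := by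
    intro h0
    have h2 : P.coeff 2 = a := by simp [hP]
    have h1 : P.coeff 1 = b := by simp [hP]
    rw [h0, Polynomial.coeff_zero] at h1 h2
    rcases hab with ha | hb
    · exact ha h2.symm
    · exact hb h1.symm
  refine (P.roots.toFinset.finite_toSet).subset fun x hx => ?_
  rw [Set.mem_setOf_eq] at hx
  rw [Finset.mem_coe, Multiset.mem_toFinset, Polynomial.mem_roots hP0, Polynomial.IsRoot.def]
  simp [hP, hx]

/-- **Perpendicular bisectors are null.** For `p ≠ q` in `ℍ` the set `{z : ρ(z, p) = ρ(z, q)}` has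
hyperbolic measure `0`: by `cosh ρ(z, w) = 1 + |z - w|² / (2 Im z Im w)` it lies in the real conic
`Im q · |z - p|² = Im p · |z - q|²`, each horizontal section of which is the zero set of a non-zero
polynomial of degree `≤ 2` in `Re z` (a circle or a line), hence finite; Fubini. [folklore] -/
theorem volume_setOf_dist_eq_dist (p q : ℍ) (hpq : p ≠ q) :
    volume {z : ℍ | dist z p = dist z q} = 0 := by
  -- the conic in `ℝ × ℝ`
  set a : ℝ := q.im - p.im with ha
  set b : ℝ := 2 * (q.re * p.im - p.re * q.im) with hb
  set c : ℝ → ℝ := fun y => (p.re ^ 2 + (y - p.im) ^ 2) * q.im - (q.re ^ 2 + (y - q.im) ^ 2) * p.im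
    with hc
  set Z : Set (ℝ × ℝ) := {w | a * w.1 ^ 2 + b * w.1 + c w.2 = 0} with hZ
  have hZm : MeasurableSet Z := by
    refine measurableSet_eq_fun ?_ measurable_const
    fun_prop
  have hab : a ≠ 0 ∨ b ≠ 0 := by
    by_cases h : a = 0
    · right
      have hpq_im : q.im = p.im := by rw [ha] at h; linarith
      have hre : p.re ≠ q.re := by
        intro hre
        exact hpq (UpperHalfPlane.ext (Complex.ext hre hpq_im.symm))
      rw [hb, hpq_im]
      have hp0 : p.im ≠ 0 := p.im_pos.ne'
      intro h0
      apply hre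
      have : (q.re - p.re) * p.im = 0 := by linarith
      rcases mul_eq_zero.mp this with h1 | h1
      · linarith
      · exact absurd h1 hp0
    · left; exact h
  have hZ0 : volume Z = 0 := by
    rw [Measure.volume_eq_prod, Measure.prod_apply_symm hZm]
    have : ∀ y : ℝ, volume ((fun x : ℝ => (x, y)) ⁻¹' Z) = 0 := fun y =>
      (finite_setOf_quadratic_eq_zero (c := c y) hab).measure_zero volume
    simp only [this, lintegral_zero]
  -- the bisector lies in the conic
  have hC : volume (Complex.measurableEquivRealProd ⁻¹' Z) = 0 := by
    rw [Complex.volume_preserving_equiv_real_prod.measure_preimage hZm.nullMeasurableSet, hZ0]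
  apply volume_eq_zero_of_image_coe
  refine measure_mono_null ?_ hC
  rintro _ ⟨z, hz, rfl⟩
  rw [Set.mem_setOf_eq] at hz
  have h := congrArg Real.cosh hz
  rw [cosh_dist, cosh_dist, add_right_inj] at h
  have hzim : z.im ≠ 0 := z.im_pos.ne'
  have hp0 : p.im ≠ 0 := p.im_pos.ne'
  have hq0 : q.im ≠ 0 := q.im_pos.ne'
  have h2 : dist (z : ℂ) p ^ 2 * q.im = dist (z : ℂ) q ^ 2 * p.im := by
    field_simp at h
    linarith [h]
  rw [Complex.dist_eq, Complex.dist_eq, Complex.sq_norm, Complex.sq_norm, Complex.normSq_apply,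
    Complex.normSq_apply] at h2
  simp only [Complex.sub_re, Complex.sub_im, UpperHalfPlane.coe_re, UpperHalfPlane.coe_im] at h2
  rw [Set.mem_preimage, Complex.measurableEquivRealProd_apply, hZ, Set.mem_setOf_eq]
  simp only [ha, hb, hc, UpperHalfPlane.coe_re, UpperHalfPlane.coe_im]
  nlinarith [h2]


/-! ### 3. The Dirichlet pair `F₀ ⊆ F₁` -/

/-- **The open Dirichlet set is open** (local finiteness of the orbit of the centre): near `z₀`
only the finitely many `γ` with `ρ(γ p, p) ≤ 2 ρ(z₀, p) + 2` constrain. [folklore] -/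
theorem isOpen_dirichletOpen
    (hΓ : Γ ≤ (Matrix.SpecialLinearGroup.toGL : SL(2, ℝ) →* GL (Fin 2) ℝ).range)
    (hd : IsDiscreteSubgroup Γ) (p : ℍ) :
    IsOpen {z : ℍ | ∀ γ ∈ Γ, γ • p ≠ p → dist z p < dist z (γ • p)} := by
  rw [isOpen_iff_forall_mem_open]
  intro z₀ hz₀
  set Φ : Set (GL (Fin 2) ℝ) := {γ | γ ∈ Γ ∧ dist (γ • p) p ≤ 2 * dist z₀ p + 2} with hΦ
  have hΦf : Φ.Finite := finite_dist_le hΓ hd p p _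
  set V : Set ℍ := Metric.ball z₀ 1 ∩ ⋂ γ ∈ Φ, {z : ℍ | γ • p ≠ p → dist z p < dist z (γ • p)}
    with hV
  refine ⟨V, ?_, ?_, ?_⟩
  · -- `V ⊆ F₀`
    rintro z ⟨hz1, hz2⟩ γ hγ hγp
    rw [Metric.mem_ball] at hz1
    by_cases hγΦ : γ ∈ Φ
    · exact (mem_iInter₂.mp hz2 γ hγΦ) hγp
    · have hfar : 2 * dist z₀ p + 2 < dist (γ • p) p := by
        by_contra h
        exact hγΦ ⟨hγ, not_lt.mp h⟩
      have h1 : dist z p ≤ dist z z₀ + dist z₀ p := dist_triangle _ _ _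
      have h2 : dist (γ • p) p ≤ dist (γ • p) z + dist z p := dist_triangle _ _ _
      rw [dist_comm (γ • p) z] at h2
      linarith
  · -- `V` is open
    refine Metric.isOpen_ball.inter (hΦf.isOpen_biInter fun γ _ => ?_)
    by_cases hγp : γ • p = p
    · have : {z : ℍ | γ • p ≠ p → dist z p < dist z (γ • p)} = Set.univ :=
        Set.eq_univ_of_forall fun z h => absurd hγp h
      rw [this]; exact isOpen_univ
    · have : {z : ℍ | γ • p ≠ p → dist z p < dist z (γ • p)} = {z | dist z p < dist z (γ • p)} :=
        Set.ext fun z => ⟨fun h => h hγp, fun h _ => h⟩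
      rw [this]
      exact isOpen_lt (continuous_id.dist continuous_const) (continuous_id.dist continuous_const)
  · refine ⟨Metric.mem_ball_self one_pos, mem_iInter₂.mpr fun γ hγ => ?_⟩
    exact hz₀ γ hγ.1

/-- The closed Dirichlet set is closed. [folklore] -/
theorem isClosed_dirichletClosed (p : ℍ) :
    IsClosed {z : ℍ | ∀ γ ∈ Γ, dist z p ≤ dist z (γ • p)} := by
  have : {z : ℍ | ∀ γ ∈ Γ, dist z p ≤ dist z (γ • p)} = ⋂ γ ∈ Γ, {z : ℍ | dist z p ≤ dist z (γ • p)} := by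
    ext z; simp only [mem_setOf_eq, mem_iInter]
  rw [this]
  exact isClosed_biInter fun γ _ =>
    isClosed_le (continuous_id.dist continuous_const) (continuous_id.dist continuous_const)

/-- The open Dirichlet set is measurable (it is open; `ℍ` is a Borel space). [folklore] -/
theorem measurableSet_dirichletOpen
    (hΓ : Γ ≤ (Matrix.SpecialLinearGroup.toGL : SL(2, ℝ) →* GL (Fin 2) ℝ).range)
    (hd : IsDiscreteSubgroup Γ) (p : ℍ) :
    MeasurableSet {z : ℍ | ∀ γ ∈ Γ, γ • p ≠ p → dist z p < dist z (γ • p)} :=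
  (isOpen_dirichletOpen hΓ hd p).measurableSet

/-- **Every orbit meets the closed Dirichlet set** (a point of the orbit nearest to `p` exists
because only finitely many orbit points are nearer to `p` than `z`). [folklore] -/
theorem exists_smul_mem_dirichletClosed
    (hΓ : Γ ≤ (Matrix.SpecialLinearGroup.toGL : SL(2, ℝ) →* GL (Fin 2) ℝ).range)
    (hd : IsDiscreteSubgroup Γ) (p z : ℍ) :
    ∃ γ₀ ∈ Γ, γ₀ • z ∈ {z : ℍ | ∀ γ ∈ Γ, dist z p ≤ dist z (γ • p)} := by
  obtain ⟨γ₀, hγ₀, h⟩ := exists_smul_forall_key_le (Γ := Γ) (key := fun w : ℍ => dist w p) (z := z)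
    (finite_dist_le hΓ hd z p (dist z p))
  refine ⟨γ₀, hγ₀, fun γ hγ => ?_⟩
  rw [dist_smul_eq_dist_inv_smul (hΓ hγ)]
  exact h γ⁻¹ (inv_mem hγ)

/-- **Two points of the open Dirichlet set in the same orbit differ by `±1`**, provided the centre
`p` has stabiliser `{±1}`. [folklore] -/
theorem eq_one_or_neg_one_of_smul_mem_dirichletOpen
    (hΓ : Γ ≤ (Matrix.SpecialLinearGroup.toGL : SL(2, ℝ) →* GL (Fin 2) ℝ).range) {p : ℍ}
    (hp : ∀ γ ∈ Γ, γ • p = p → γ = 1 ∨ γ = -1) {z : ℍ}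
    (hz : z ∈ {z : ℍ | ∀ γ ∈ Γ, γ • p ≠ p → dist z p < dist z (γ • p)})
    {γ : GL (Fin 2) ℝ} (hγ : γ ∈ Γ)
    (hγz : γ • z ∈ {z : ℍ | ∀ γ ∈ Γ, γ • p ≠ p → dist z p < dist z (γ • p)}) :
    γ = 1 ∨ γ = -1 := by
  by_contra hne
  have hγp : γ • p ≠ p := fun h => hne (hp γ hγ h)
  have hγp' : γ⁻¹ • p ≠ p := by
    intro h
    apply hγp
    have := congrArg (γ • ·) h
    simpa only [smul_inv_smul] using this.symm
  have h1 := hz γ⁻¹ (inv_mem hγ) hγp'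
  rw [dist_smul_eq_dist_inv_smul (hΓ (inv_mem hγ)), inv_inv] at h1
  have h2 := hγz γ hγ hγp
  rw [dist_smul_smul_of_mem_range (hΓ hγ)] at h2
  exact lt_asymm h1 h2

/-- `F₁ ∖ F₀` lies in the perpendicular bisectors of `p` and the orbit points `γ p ≠ p`, hence is
null. [folklore] -/
theorem volume_dirichletClosed_diff_dirichletOpen (hd : IsDiscreteSubgroup Γ) (p : ℍ) :
    volume ({z : ℍ | ∀ γ ∈ Γ, dist z p ≤ dist z (γ • p)} \
      {z : ℍ | ∀ γ ∈ Γ, γ • p ≠ p → dist z p < dist z (γ • p)}) = 0 := by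
  haveI := hd.countable_subtype
  have hsub : ({z : ℍ | ∀ γ ∈ Γ, dist z p ≤ dist z (γ • p)} \
      {z : ℍ | ∀ γ ∈ Γ, γ • p ≠ p → dist z p < dist z (γ • p)}) ⊆
      ⋃ γ : Γ, {z : ℍ | (γ : GL (Fin 2) ℝ) • p ≠ p ∧ dist z p = dist z ((γ : GL (Fin 2) ℝ) • p)} := by
    rintro z ⟨h1, h2⟩
    simp only [mem_setOf_eq, not_forall, exists_prop, not_lt] at h2
    obtain ⟨γ, hγ, hγp, hle⟩ := h2
    exact mem_iUnion.mpr ⟨⟨γ, hγ⟩, hγp, le_antisymm (h1 γ hγ) hle⟩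
  refine measure_mono_null hsub (measure_iUnion_null fun γ => ?_)
  by_cases hγp : (γ : GL (Fin 2) ℝ) • p = p
  · have : {z : ℍ | (γ : GL (Fin 2) ℝ) • p ≠ p ∧ dist z p = dist z ((γ : GL (Fin 2) ℝ) • p)} = ∅ :=
      Set.eq_empty_of_forall_notMem fun z h => h.1 hγp
    rw [this, measure_empty]
  · exact measure_mono_null (fun z h => h.2) (volume_setOf_dist_eq_dist p _ (Ne.symm hγp))

/-- **The Dirichlet pair of a cocompact discrete subgroup of `SL₂(ℝ)`.** For `Γ ≤ SL₂(ℝ)`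
discrete and cocompact there are an open set `F₀` and a closed set `F₁ ⊇ F₀` of `ℍ` such that:
`F₁` lies in a compact ball; every orbit meets `F₁`; two points of `F₀` in the same orbit differ by
`±1 ∈ Γ` only; `μ(F₁ ∖ F₀) = μ(∂F₀) = μ(∂F₁) = 0`; and `F₁` is a (measure-theoretic) fundamental
domain (`IsHypFundamentalDomain`). Dirichlet's construction (Vignéras IV §2; Beardon §9.4) with a
centre of trivial stabiliser in `Γ/{±1}`. [cite: VignerasLNM800, Ch. IV §2 (domaine de Dirichlet)] -/
theorem exists_dirichletDomain_pair
    (hΓ : Γ ≤ (Matrix.SpecialLinearGroup.toGL : SL(2, ℝ) →* GL (Fin 2) ℝ).range)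
    (hd : IsDiscreteSubgroup Γ) (hK : ∃ K : Set ℍ, IsCompact K ∧ ∀ z : ℍ, ∃ γ ∈ Γ, γ • z ∈ K) :
    ∃ F₀ F₁ : Set ℍ, F₀ ⊆ F₁ ∧ IsOpen F₀ ∧ IsClosed F₁ ∧
      (∃ (p : ℍ) (R : ℝ), F₁ ⊆ Metric.closedBall p R) ∧
      (∀ z : ℍ, ∃ γ ∈ Γ, γ • z ∈ F₁) ∧
      (∀ z ∈ F₀, ∀ γ ∈ Γ, γ • z ∈ F₀ → γ = 1 ∨ γ = -1) ∧
      volume (F₁ \ F₀) = 0 ∧ volume (frontier F₀) = 0 ∧ volume (frontier F₁) = 0 ∧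
      IsHypFundamentalDomain Γ F₁ := by
  haveI := hd.countable_subtype
  obtain ⟨p, hp⟩ := exists_forall_smul_eq_self_imp hΓ hd
  obtain ⟨K, hKc, hKcov⟩ := hK
  set F₀ : Set ℍ := {z : ℍ | ∀ γ ∈ Γ, γ • p ≠ p → dist z p < dist z (γ • p)} with hF₀
  set F₁ : Set ℍ := {z : ℍ | ∀ γ ∈ Γ, dist z p ≤ dist z (γ • p)} with hF₁
  have hsub : F₀ ⊆ F₁ := by
    intro z hz γ hγ
    by_cases hγp : γ • p = p
    · rw [hγp]
    · exact (hz γ hγ hγp).le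
  have hopen : IsOpen F₀ := isOpen_dirichletOpen hΓ hd p
  have hclosed : IsClosed F₁ := isClosed_dirichletClosed p
  have hdiff : volume (F₁ \ F₀) = 0 := volume_dirichletClosed_diff_dirichletOpen hd p
  have hcov : ∀ z : ℍ, ∃ γ ∈ Γ, γ • z ∈ F₁ := exists_smul_mem_dirichletClosed hΓ hd p
  have huniq : ∀ z ∈ F₀, ∀ γ ∈ Γ, γ • z ∈ F₀ → γ = 1 ∨ γ = -1 := fun z hz γ hγ hγz =>
    eq_one_or_neg_one_of_smul_mem_dirichletOpen hΓ hp hz hγ hγz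
  -- boundedness from cocompactness
  obtain ⟨R, hR⟩ := hKc.isBounded.subset_closedBall p
  have hbdd : F₁ ⊆ Metric.closedBall p R := by
    intro z hz
    obtain ⟨γ, hγ, hγz⟩ := hKcov z
    rw [Metric.mem_closedBall]
    calc dist z p ≤ dist z (γ⁻¹ • p) := hz γ⁻¹ (inv_mem hγ)
      _ = dist (γ • z) p := by rw [dist_smul_eq_dist_inv_smul (hΓ (inv_mem hγ)), inv_inv]
      _ ≤ R := Metric.mem_closedBall.mp (hR hγz)
  -- boundaries
  have hfr₀ : volume (frontier F₀) = 0 := by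
    refine measure_mono_null ?_ hdiff
    rw [frontier, hopen.interior_eq]
    exact sdiff_le_sdiff (hclosed.closure_subset_iff.mpr hsub) le_rfl
  have hfr₁ : volume (frontier F₁) = 0 := by
    refine measure_mono_null ?_ hdiff
    rw [frontier, hclosed.closure_eq]
    exact sdiff_le_sdiff le_rfl (hopen.subset_interior_iff.mpr hsub)
  refine ⟨F₀, F₁, hsub, hopen, hclosed, ⟨p, R, hbdd⟩, hcov, huniq, hdiff, hfr₀, hfr₁,
    ⟨hclosed.measurableSet, hcov, ?_⟩⟩
  -- a.e. uniqueness on `F₁`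
  have hbad : {z : ℍ | ¬ (z ∈ F₁ → ∀ γ ∈ Γ, γ • z ∈ F₁ → γ • z = z)} ⊆
      (F₁ \ F₀) ∪ ⋃ γ : Γ, (fun z => (γ : GL (Fin 2) ℝ) • z) ⁻¹' (F₁ \ F₀) := by
    intro z hz
    simp only [mem_setOf_eq, Classical.not_imp, not_forall] at hz
    obtain ⟨hz₁, γ, hγ, hγz₁, hne⟩ := hz
    by_cases hz₀ : z ∈ F₀
    · right
      refine mem_iUnion.mpr ⟨⟨γ, hγ⟩, hγz₁, fun hγz₀ => hne ?_⟩
      rcases huniq z hz₀ γ hγ hγz₀ with rfl | rfl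
      · exact one_smul _ _
      · exact UpperHalfPlane.neg_smul 1 z ▸ (one_smul _ z)
    · exact Or.inl ⟨hz₁, hz₀⟩
  rw [ae_iff]
  refine measure_mono_null hbad (measure_union_null hdiff (measure_iUnion_null fun γ => ?_))
  have hmp : MeasurePreserving (fun z : ℍ => (γ : GL (Fin 2) ℝ) • z) volume volume :=
    measurePreserving_smul _ volume
  rw [hmp.measure_preimage (hclosed.measurableSet.diff hopen.measurableSet).nullMeasurableSet]
  exact hdiff

/-! ### 4. Consequences: bounds and finite volume -/

/-- A subset of a hyperbolic ball satisfies uniform bounds `|Re z| ≤ R'`, `δ ≤ Im z ≤ R'` with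
`δ > 0` (Mathlib `dist_log_im_le`, `dist_coe_le`). [folklore] -/
theorem exists_bounds_of_subset_closedBall {F : Set ℍ} {p : ℍ} {R : ℝ}
    (hF : F ⊆ Metric.closedBall p R) :
    ∃ R' δ : ℝ, 0 < δ ∧ ∀ z ∈ F, |z.re| ≤ R' ∧ δ ≤ z.im ∧ z.im ≤ R' := by
  have hR : ∀ z ∈ F, dist z p ≤ R := fun z hz => Metric.mem_closedBall.mp (hF hz)
  refine ⟨max (|p.re| + p.im * (Real.exp R - 1)) (p.im * Real.exp R), p.im / Real.exp R,
    div_pos p.im_pos (Real.exp_pos R), fun z hz => ⟨?_, ?_, ?_⟩⟩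
  · have h1 : |z.re - p.re| ≤ dist (z : ℂ) p := by
      rw [Complex.dist_eq]
      simpa using Complex.abs_re_le_norm ((z : ℂ) - p)
    have h2 : dist (z : ℂ) p ≤ p.im * (Real.exp (dist z p) - 1) := dist_coe_le z p
    have h3 : Real.exp (dist z p) ≤ Real.exp R := Real.exp_le_exp.mpr (hR z hz)
    have h4 : p.im * (Real.exp (dist z p) - 1) ≤ p.im * (Real.exp R - 1) := by
      gcongr
    have : |z.re| ≤ |p.re| + |z.re - p.re| := by
      have := abs_add_le p.re (z.re - p.re); simpa using this
    exact le_trans (by linarith) (le_max_left _ _)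
  · have h := im_div_exp_dist_le p z
    rw [dist_comm] at h
    calc p.im / Real.exp R ≤ p.im / Real.exp (dist z p) := by
          gcongr
          exact hR z hz
      _ ≤ z.im := h
  · calc z.im ≤ p.im * Real.exp (dist z p) := im_le_im_mul_exp_dist z p
      _ ≤ p.im * Real.exp R := by gcongr; exact hR z hz
      _ ≤ _ := le_max_right _ _

/-- A subset of a hyperbolic ball has finite hyperbolic volume (it lies in a compact set). [folklore] -/
theorem volume_lt_top_of_subset_closedBall {F : Set ℍ} {p : ℍ} {R : ℝ}
    (hF : F ⊆ Metric.closedBall p R) : volume F < ⊤ :=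
  lt_of_le_of_lt (measure_mono hF) (isCompact_closedBall p R).measure_lt_top

end Literature.NumberTheory.Automorphic

end
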